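/-
Origin: expansion seat `prover-pub-hodgecm-mc-carch-1-g6-0`, handover #CA60 2026-08-20T14:44:39Z r2 md5 fdc83a5503b5 (468 l., 31 theorems; NEW additive leaf; imports RUN-51 sinst-1 #1229 Model.ThetaAdelicSideR2 only (PKG); RUN 53; drop-alone; cert certs/ax-ThetaAdelicSideGuardedT2Ops-fdc83a5503b5.log: rc 0 / 46 s / 0 warnings / trio 28/28) (`HOME/mc/pub-hodgecm-mc-carch-1/pkg53/HodgeCM/Model/ThetaAdelicSideGuardedT2Ops.lean`, md5 fdc83a5503b5, 468 lines);
landed by the gen-21 packager (p-g21) in gate run 53 as `HodgeCM/Model/ThetaAdelicSideGuardedT2Ops.lean` (verbatim).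
-/
/-
Origin: CONSTRUCTION seat `prover-pub-hodgecm-mc-carch-1-g6-0` (unit pub-hodgecm-mc-carch-1-g6, gen 6 of mc-carch-1 — C / ARCHDATUM BUILDER,
BINDER-OWNERS row 12 `C` + row 17 (W-0-supply) at the pin), 2026-08-20; for binder-1-g13's PIN QUESTION (STATUS l.13567) and glue-1-g11's
bridge job (l.13608).  Target in PKG: `HodgeCM/Model/ThetaAdelicSideGuardedT2Ops.lean` (NEW additive drop-alone leaf; imports INSTALLED RUN-51
sinst-1 #1229 `Model/ThetaAdelicSideR2` only — hence #1228 `ThetaAdelicSideGuardedT2` and period-1 #P50b `ArchSideOfTwist34`).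
KERNEL only: theorems, 0 defs, 0 records, nothing cited, 0 `def … : Prop`; intended closure {propext, Classical.choice, Quot.sound}.
Nothing here is a claim of PerL ∕ QW8.
-/
import Summits.HodgeConjecture.HodgeCM.Model.ThetaAdelicSideR2

/-!
# The read-backs of the guarded DOUBLY TWISTED S term and of the constructed pin R2 `SROGT'C` ∕ `SROGT'CJ`

binder-1 #35 `ThetaAdelicSideGuardedPOps` gave the four COMPOSITE read-backs of the predicate-guarded untwisted term `thetaAdelicSideOfP`
(`regimeEquiv_prodSymm_one_mem_…_Gfin`, `op_`, `seesaw34_`, `op34_…`), which binder-1's row-16∕17 layers over `SInstance.SGP` consume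
(`Binders/Gen12PinsTotalP`: `ST_eq_archSideOf`, `ST_ιinf`, `op_total`, `seesaw34_total`, `op34_total`, `hι_total`, `ST_P_w`, `hGfin_total`).
E's closing chain now sits at the CONSTRUCTED pin R2 `SInstance.SROGT'CJ` (glue-1 #397J2, RUN 51), an instance of sinst-1's guarded doubly
twisted family `thetaAdelicSideOfPT'` (#1228) — NOT of `SGP`: under the guard its line kernels are `lineRepT' … η νR ν'R k`, whose lines 1∕3
act on `U(V)(𝔸) × 1` through `νR`∕`ν'R` (`etaT₁/etaT₃_apply_mk_one`), while every `SGP`'s lines 1∕3 are trivial there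
(`eta₁/eta₃_apply_mk_one`).  So the row-16∕17 layers must be re-typed over a general side; this leaf supplies, BY NAME, every S-side fact
they read, at the doubly twisted term and at the pin:

* § 1 (`ArchSideTerm`, any guard `G`): `thetaAdelicSideOfPT'_P_ΓU` (both branches), `thetaAdelicSideOfPT'_ιinf`, `thetaAdelicSideOfPT'_Gfin`,
  `regimeEquiv_prodSymm_one_mem_thetaAdelicSideOfPT'_Gfin`, `op_thetaAdelicSideOfPT'`, `seesaw34_thetaAdelicSideOfPT'`,
  `op34_thetaAdelicSideOfPT'` — each `rw [thetaAdelicSideOfPT'_eq_archSideOfT' … hc]; exact <#P50b's archSideOfT' statement>`;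
* § 2 (`SInstance`): for ANY guard the transported read-off inputs' read-backs `ART'_Φinf`, `ART'_x₀`, **`ART'_w : (ART' … hc k).w =
  ⇑(archWeight L (μ c k))`** (binder-1's `hAw_AR` with `AR ↦ ART'`); at the pin `SROGT'C @hGR @hGR₀ @hGR₁ @hGR₂ @hGR₃ @μ hΔ₁ hΔ₂ hΔ₃` under
  `hc : GOG V c`: `SROGT'C_P_ΓU`, `SROGT'C_ιinf`, `SROGT'C_Gfin`,
  `SROGT'C_ιinf_apply`, `regimeEquiv_prodSymm_one_mem_SROGT'C_Gfin`, `SROGT'C_P_Φinf`, `SROGT'C_P_x₀` (= the (J-μ) read-off inputs `AR … k`),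
  **`SROGT'C_P_w : ((SROGT'C … V c).P k).w = ⇑(archWeight L (μ c k))`** (binder-1's two weight facts, all four lines), `op_SROGT'C`,
  `seesaw34_SROGT'C`, `op34_SROGT'C`;
* § 3 the same names at the (J-μ)-closed pin `SROGT'CJ @hGR @hGR₀ @hGR₁ @hGR₂ @hGR₃ @μ` (one-liners; the weight table there is
  `μ♯♯ := ArchSideTerm.muSharp₂₃ μ`, as #397J2 reads `d34Of (muSharp₂₃ μ)`).
ADDITIVE leaf: no existing declaration is touched; no records, no cited facts, no E-binder.
-/

set_option autoImplicit false

noncomputable section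

open scoped Matrix SchwartzMap
open NumberField NumberField.mixedEmbedding
open Literature.NumberTheory.Automorphic Literature.NumberTheory.Weil1964
open Literature.NumberTheory.GelbartRogawski1991.UnitaryDualPair
open HodgeCM.Adelic HodgeCM.PerL34
open Literature.Geometry.ComplexHyperbolic.BallModel (U21)

namespace HodgeCM.Model

namespace ArchSideTerm

/-! ## § 1 the guarded doubly twisted term, any guard -/

section GuardedT2Ops

variable {L : CMField} {ι₁ : L →+* ℂ} (V : HermSpace3 L ι₁) (c : SeesawCtx L) (G : Prop)
  (hG : G → (∀ j, 0 < (ι₁ (dW c.D j)).re) ∨ ∀ j, (ι₁ (dW c.D j)).re < 0)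
  (hGR : (cmSplittingDatum (L : Type) finProdFinEquiv (frameD V) (frameD_real V) (frameD_ne V) (dW c.D) (dW_real c.D)
    (dW_ne c.D)).CompatibleSplitting)
  (hGR₀ : (cmSplittingDatum (L : Type) (e₁) (frameD V) (frameD_real V) (frameD_ne V) (lineVec (L : Type) (dW c.D 0))
    (fun _ => dW_real c.D 0) (fun _ => dW_ne c.D 0)).CompatibleSplitting)
  (hGR₁ : (cmSplittingDatum (L : Type) (e₁) (frameD V) (frameD_real V) (frameD_ne V) (lineVec (L : Type) (dW c.D 1))
    (fun _ => dW_real c.D 1) (fun _ => dW_ne c.D 1)).CompatibleSplitting)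
  (hGR₂ : (cmSplittingDatum (L : Type) (e₁) (frameD V) (frameD_real V) (frameD_ne V) (lineVec (L : Type) (dW' c.D 0))
    (fun _ => dW'_real c.D 0) (fun _ => dW'_ne c.D 0)).CompatibleSplitting)
  (hGR₃ : (cmSplittingDatum (L : Type) (e₁) (frameD V) (frameD_real V) (frameD_ne V) (lineVec (L : Type) (dW' c.D 1))
    (fun _ => dW'_real c.D 1) (fun _ => dW'_ne c.D 1)).CompatibleSplitting)
  (η : CMAdelic (L : Type) (frameD V) × CMAdelic (L : Type) (dW c.D) →* ℂˣ)
  (hη : ∀ γU ∈ CMRat (L : Type) (frameD V), ∀ γ ∈ CMRat (L : Type) (dW c.D), η (γU, γ) = 1)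
  (hηc : Continuous fun p => ((η p : ℂˣ) : ℂ))
  (ν : CMAdelic (L : Type) (frameD V) →* ℂˣ)
  (hν : ∀ γU ∈ CMRat (L : Type) (frameD V), ν γU = 1)
  (hνc : Continuous fun v => ((ν v : ℂˣ) : ℂ))
  (ν' : CMAdelic (L : Type) (frameD V) →* ℂˣ)
  (hν' : ∀ γU ∈ CMRat (L : Type) (frameD V), ν' γU = 1)
  (hν'c : Continuous fun v => ((ν' v : ℂˣ) : ℂ))
  (AG : G → ∀ k : Fin 4, ArchLineInput V (lineRepT' V c.D hGR hGR₀ hGR₁ hGR₂ hGR₃ η ν ν' k))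

/-- `(P k).ΓU` of the guarded doubly twisted term is the lattice model's `Γ`, on BOTH branches (structure field `hΓU`). -/
theorem thetaAdelicSideOfPT'_P_ΓU (k : Fin 4) :
    ((thetaAdelicSideOfPT' V c G hG hGR hGR₀ hGR₁ hGR₂ hGR₃ η hη hηc ν hν hνc ν' hν' hν'c AG).P k).ΓU =
      (V.latticeModel printFact_unitaryCompact_holds).Γ :=
  (thetaAdelicSideOfPT' V c G hG hGR hGR₀ hGR₁ hGR₂ hGR₃ η hη hηc ν hν hνc ν' hν' hν'c AG).hΓU k

/-- under the guard `ιinf = archInfOf V`. -/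
theorem thetaAdelicSideOfPT'_ιinf (hc : G) :
    (thetaAdelicSideOfPT' V c G hG hGR hGR₀ hGR₁ hGR₂ hGR₃ η hη hηc ν hν hνc ν' hν' hν'c AG).ιinf = archInfOf V := by
  rw [thetaAdelicSideOfPT'_eq_archSideOfT' V c G hG hGR hGR₀ hGR₁ hGR₂ hGR₃ η hη hηc ν hν hνc ν' hν' hν'c AG hc]; rfl

/-- under the guard `Gfin = archFinOf V`. -/
theorem thetaAdelicSideOfPT'_Gfin (hc : G) :
    (thetaAdelicSideOfPT' V c G hG hGR hGR₀ hGR₁ hGR₂ hGR₃ η hη hηc ν hν hνc ν' hν' hν'c AG).Gfin = archFinOf V := by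
  rw [thetaAdelicSideOfPT'_eq_archSideOfT' V c G hG hGR hGR₀ hGR₁ hGR₂ hGR₃ η hη hηc ν hν hνc ν' hν' hν'c AG hc]; rfl

/-- (L3b) at the guarded doubly twisted term: `regimeEquiv … (e.symm (1, k_f)) ∈ Gfin` under the guard (#P50b at the term). -/
theorem regimeEquiv_prodSymm_one_mem_thetaAdelicSideOfPT'_Gfin (hc : G) (hV : IsAnisotropic L V.Hm)
    (kf : ↥(UnitaryGroup.finAdelic (↥(maximalRealSubfield L)) (L : Type) (IsCMField.complexConj L) 3 V.Hm)) :
    (Adelic.regimeEquiv L V.Hm hV ((UnitaryGroup.cmAdelicProdEquiv (L : Type) 3 V.Hm).symm (1, kf)) :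
        (V.latticeModel printFact_unitaryCompact_holds).G) ∈
      (thetaAdelicSideOfPT' V c G hG hGR hGR₀ hGR₁ hGR₂ hGR₃ η hη hηc ν hν hνc ν' hν' hν'c AG).Gfin := by
  rw [thetaAdelicSideOfPT'_Gfin V c G hG hGR hGR₀ hGR₁ hGR₂ hGR₃ η hη hηc ν hν hνc ν' hν' hν'c AG hc]
  exact regimeEquiv_prodSymm_one_mem_archFinOf V hV kf

/-- binder-1's **`op`** at the guarded doubly twisted term under the guard: #P50b `op_archSideOfT'` (`ν` cancels on the (12) torus). -/
theorem op_thetaAdelicSideOfPT' (hc : G)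
    (g : ↥(regimeSubgroup L V.Hm)) (t : NumberField.SeesawTorus (↥(maximalRealSubfield L)) L)
    (φ₁ φ₂ : piSchwartzBruhat (↥(maximalRealSubfield L)) (Fin 3)) :
    cmPairRepTwist (L : Type) finProdFinEquiv (frameD V) (frameD_real V) (frameD_ne V) (dW c.D) (dW_real c.D) (dW_ne c.D) hGR η
        ((cmFrameEquiv (L : Type) (frameG V) V.Hm (frameD V) (frame_congr V)) (g : ↥(HodgeCM.Adelic.adelicUnitaryGroup (L : Type) V.Hm)),
          cmAdelicEquiv (L : Type) 2 (Matrix.diagonal (dW c.D)) (c.D.jT₁₂ t)) (tau12 V c.D φ₁ φ₂) =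
      tau12 V c.D
        (((thetaAdelicSideOfPT' V c G hG hGR hGR₀ hGR₁ hGR₂ hGR₃ η hη hηc ν hν hνc ν' hν' hν'c AG).P 0).ω (g, NumberField.SeesawTorus.fst _ L t) φ₁)
        (((thetaAdelicSideOfPT' V c G hG hGR hGR₀ hGR₁ hGR₂ hGR₃ η hη hηc ν hν hνc ν' hν' hν'c AG).P 1).ω (g, NumberField.SeesawTorus.snd _ L t) φ₂) := by
  rw [thetaAdelicSideOfPT'_eq_archSideOfT' V c G hG hGR hGR₀ hGR₁ hGR₂ hGR₃ η hη hηc ν hν hνc ν' hν' hν'c AG hc]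
  exact op_archSideOfT' V c hGR hGR₀ hGR₁ hGR₂ hGR₃ η hη hηc ν hν hνc ν' hν' hν'c (hG hc) (AG hc) g t φ₁ φ₂

/-- binder-1's **`seesaw`** (`SeesawHyp34`) at the guarded doubly twisted term under the guard: #P50b `seesaw34_archSideOfT'` (`ν′` cancels
on the (34) torus). -/
theorem seesaw34_thetaAdelicSideOfPT' (hc : G)
    (g : ↥(regimeSubgroup L V.Hm)) (t : NumberField.SeesawTorus (↥(maximalRealSubfield L)) L)
    (φ₂ φ₃ : piSchwartzBruhat (↥(maximalRealSubfield L)) (Fin 3)) :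
    thetaDistLM (↥(maximalRealSubfield L)) (Fin 6)
        (cmPairRepTwist (L : Type) finProdFinEquiv (frameD V) (frameD_real V) (frameD_ne V) (dW c.D) (dW_real c.D) (dW_ne c.D) hGR η
          ((cmFrameEquiv (L : Type) (frameG V) V.Hm (frameD V) (frame_congr V)) (g : ↥(HodgeCM.Adelic.adelicUnitaryGroup (L : Type) V.Hm)),
            cmAdelicEquiv (L : Type) 2 (Matrix.diagonal (dW c.D)) (c.D.jT₃₄ t)) (tau34 V c.D φ₂ φ₃)) =
      thetaDistLM (↥(maximalRealSubfield L)) (Fin 3)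
          ((((thetaAdelicSideOfPT' V c G hG hGR hGR₀ hGR₁ hGR₂ hGR₃ η hη hηc ν hν hνc ν' hν' hν'c AG).P 2).ω (g, NumberField.SeesawTorus.fst _ L t) φ₂)) *
        thetaDistLM (↥(maximalRealSubfield L)) (Fin 3)
          ((((thetaAdelicSideOfPT' V c G hG hGR hGR₀ hGR₁ hGR₂ hGR₃ η hη hηc ν hν hνc ν' hν' hν'c AG).P 3).ω (g, NumberField.SeesawTorus.snd _ L t) φ₃)) := by
  rw [thetaAdelicSideOfPT'_eq_archSideOfT' V c G hG hGR hGR₀ hGR₁ hGR₂ hGR₃ η hη hηc ν hν hνc ν' hν' hν'c AG hc]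
  exact seesaw34_archSideOfT' V c hGR hGR₀ hGR₁ hGR₂ hGR₃ η hη hηc ν hν hνc ν' hν' hν'c (hG hc) (AG hc) g t φ₂ φ₃

/-- the operator-level (34) identity at the guarded doubly twisted term under the guard: #P50b `op34_archSideOfT'`. -/
theorem op34_thetaAdelicSideOfPT' (hc : G)
    (g : ↥(regimeSubgroup L V.Hm)) (t : NumberField.SeesawTorus (↥(maximalRealSubfield L)) L)
    (φ₂ φ₃ : piSchwartzBruhat (↥(maximalRealSubfield L)) (Fin 3)) :
    cmPairRepTwist (L : Type) finProdFinEquiv (frameD V) (frameD_real V) (frameD_ne V) (dW c.D) (dW_real c.D) (dW_ne c.D) hGR η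
        ((cmFrameEquiv (L : Type) (frameG V) V.Hm (frameD V) (frame_congr V)) (g : ↥(HodgeCM.Adelic.adelicUnitaryGroup (L : Type) V.Hm)),
          cmAdelicEquiv (L : Type) 2 (Matrix.diagonal (dW c.D)) (c.D.jT₃₄ t)) (tau34 V c.D φ₂ φ₃) =
      tau34 V c.D
        (((thetaAdelicSideOfPT' V c G hG hGR hGR₀ hGR₁ hGR₂ hGR₃ η hη hηc ν hν hνc ν' hν' hν'c AG).P 2).ω (g, NumberField.SeesawTorus.fst _ L t) φ₂)
        (((thetaAdelicSideOfPT' V c G hG hGR hGR₀ hGR₁ hGR₂ hGR₃ η hη hηc ν hν hνc ν' hν' hν'c AG).P 3).ω (g, NumberField.SeesawTorus.snd _ L t) φ₃) := by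
  rw [thetaAdelicSideOfPT'_eq_archSideOfT' V c G hG hGR hGR₀ hGR₁ hGR₂ hGR₃ η hη hηc ν hν hνc ν' hν' hν'c AG hc]
  exact op34_archSideOfT' V c hGR hGR₀ hGR₁ hGR₂ hGR₃ η hη hηc ν hν hνc ν' hν' hν'c (hG hc) (AG hc) g t φ₂ φ₃

end GuardedT2Ops

end ArchSideTerm

/-! ## § 2 the constructed pin R2 `SROGT'C` under the OG guard -/

namespace SInstance

open HodgeCM.Model.ArchSideTerm

/-! ### § 2a the transported read-off inputs `ART'` (any guard): `Φ_∞`, `x₀` are `AR`'s, the weight is `archWeight L (μ c k)` -/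

section ReadOffT2

variable
  (G : ∀ {L : CMField} {ι₁ : L →+* ℂ} (_V : HermSpace3 L ι₁) (_c : SeesawCtx L), Prop)
  (hG : ∀ {L : CMField} {ι₁ : L →+* ℂ} (V : HermSpace3 L ι₁) (c : SeesawCtx L), G V c → (∀ j, 0 < (ι₁ (dW c.D j)).re) ∨ ∀ j, (ι₁ (dW c.D j)).re < 0)
  (hGR : ∀ {L : CMField} {ι₁ : L →+* ℂ} (V : HermSpace3 L ι₁) (c : SeesawCtx L),
    (cmSplittingDatum (L : Type) finProdFinEquiv (frameD V) (frameD_real V) (frameD_ne V) (dW c.D) (dW_real c.D)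
      (dW_ne c.D)).CompatibleSplitting)
  (χV : ∀ {L : CMField} {ι₁ : L →+* ℂ} (_V : HermSpace3 L ι₁) (_c : SeesawCtx L),
    ContinuousMonoidHom (Literature.NumberTheory.Automorphic.relNormOneIdeles (↥(NumberField.maximalRealSubfield (L : Type))) (L : Type) ⧸
      Literature.NumberTheory.Automorphic.relNormOneRat (↥(NumberField.maximalRealSubfield (L : Type))) (L : Type)) Circle)
  (ν : ∀ {L : CMField} {ι₁ : L →+* ℂ} (V : HermSpace3 L ι₁) (_c : SeesawCtx L), CMAdelic (L : Type) (frameD V) →* ℂˣ)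
  (ν' : ∀ {L : CMField} {ι₁ : L →+* ℂ} (V : HermSpace3 L ι₁) (_c : SeesawCtx L), CMAdelic (L : Type) (frameD V) →* ℂˣ)
  (hGR₀ : ∀ {L : CMField} {ι₁ : L →+* ℂ} (V : HermSpace3 L ι₁) (c : SeesawCtx L),
    (cmSplittingDatum (L : Type) (e₁) (frameD V) (frameD_real V) (frameD_ne V) (lineVec (L : Type) (dW c.D 0))
      (fun _ => dW_real c.D 0) (fun _ => dW_ne c.D 0)).CompatibleSplitting)
  (hGR₁ : ∀ {L : CMField} {ι₁ : L →+* ℂ} (V : HermSpace3 L ι₁) (c : SeesawCtx L),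
    (cmSplittingDatum (L : Type) (e₁) (frameD V) (frameD_real V) (frameD_ne V) (lineVec (L : Type) (dW c.D 1))
      (fun _ => dW_real c.D 1) (fun _ => dW_ne c.D 1)).CompatibleSplitting)
  (hGR₂ : ∀ {L : CMField} {ι₁ : L →+* ℂ} (V : HermSpace3 L ι₁) (c : SeesawCtx L),
    (cmSplittingDatum (L : Type) (e₁) (frameD V) (frameD_real V) (frameD_ne V) (lineVec (L : Type) (dW' c.D 0))
      (fun _ => dW'_real c.D 0) (fun _ => dW'_ne c.D 0)).CompatibleSplitting)
  (hGR₃ : ∀ {L : CMField} {ι₁ : L →+* ℂ} (V : HermSpace3 L ι₁) (c : SeesawCtx L),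
    (cmSplittingDatum (L : Type) (e₁) (frameD V) (frameD_real V) (frameD_ne V) (lineVec (L : Type) (dW' c.D 1))
      (fun _ => dW'_real c.D 1) (fun _ => dW'_ne c.D 1)).CompatibleSplitting)
  (μ : ∀ {L : CMField}, SeesawCtx L → Fin 4 → NumberField.InfinitePlace (L : Type) → ℤ)
  (hpos : ∀ {L : CMField} {ι₁ : L →+* ℂ} (V : HermSpace3 L ι₁) (c : SeesawCtx L), G V c →
    0 < HypCensus.cmXW (L : Type) (frameD V) (lineVec (L : Type) (dW c.D 0)) (fun _ => dW_real c.D 0) ι₁ (HypCensus.cmPlace (L : Type) ι₁) 0 ∧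
    0 < HypCensus.cmXW (L : Type) (frameD V) (lineVec (L : Type) (dW c.D 1)) (fun _ => dW_real c.D 1) ι₁ (HypCensus.cmPlace (L : Type) ι₁) 0 ∧
    0 < HypCensus.cmXW (L : Type) (frameD V) (lineVec (L : Type) (dW' c.D 0)) (fun _ => dW'_real c.D 0) ι₁ (HypCensus.cmPlace (L : Type) ι₁) 0 ∧
    0 < HypCensus.cmXW (L : Type) (frameD V) (lineVec (L : Type) (dW' c.D 1)) (fun _ => dW'_real c.D 1) ι₁ (HypCensus.cmPlace (L : Type) ι₁) 0)
  (hΔ₁ : ∀ {L : CMField} {ι₁ : L →+* ℂ} (V : HermSpace3 L ι₁) (c : SeesawCtx L), ∀ hc : G V c,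
    slotTypeVec V c (hGR V c) (hGR₀ V c) (hGR₁ V c) (hGR₂ V c) (hGR₃ V c) (hG V c hc) 1 -
      slotTypeVec V c (hGR V c) (hGR₀ V c) (hGR₁ V c) (hGR₂ V c) (hGR₃ V c) (hG V c hc) 0 = μ c 1 - μ c 0)
  (hΔ₂ : ∀ {L : CMField} {ι₁ : L →+* ℂ} (V : HermSpace3 L ι₁) (c : SeesawCtx L), ∀ hc : G V c,
    slotTypeVec V c (hGR V c) (hGR₀ V c) (hGR₁ V c) (hGR₂ V c) (hGR₃ V c) (hG V c hc) 2 -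
      slotTypeVec V c (hGR V c) (hGR₀ V c) (hGR₁ V c) (hGR₂ V c) (hGR₃ V c) (hG V c hc) 0 = μ c 2 - μ c 0)
  (hΔ₃ : ∀ {L : CMField} {ι₁ : L →+* ℂ} (V : HermSpace3 L ι₁) (c : SeesawCtx L), ∀ hc : G V c,
    slotTypeVec V c (hGR V c) (hGR₀ V c) (hGR₁ V c) (hGR₂ V c) (hGR₃ V c) (hG V c hc) 3 -
      slotTypeVec V c (hGR V c) (hGR₀ V c) (hGR₁ V c) (hGR₂ V c) (hGR₃ V c) (hG V c hc) 0 = μ c 3 - μ c 0)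

variable {L : CMField} {ι₁ : L →+* ℂ} (V : HermSpace3 L ι₁) (c : SeesawCtx L)

/-- the transported read-off input of line `k` has `AR`'s archimedean test function (#1228 `archLineInputT'_Φinf`). -/
theorem ART'_Φinf (hc : G V c) (k : Fin 4) :
    (ART' @G @hG @hGR @χV @ν @ν' @hGR₀ @hGR₁ @hGR₂ @hGR₃ @μ @hpos @hΔ₁ @hΔ₂ @hΔ₃ V c hc k).Φinf =
      (AR @G @hG @hGR @χV @hGR₀ @hGR₁ @hGR₂ @hGR₃ @μ @hpos @hΔ₁ @hΔ₂ @hΔ₃ V c hc k).Φinf := by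
  unfold ART'
  rw [archLineInputT'_Φinf]

/-- the transported read-off input of line `k` has `AR`'s rational base point (#1228 `archLineInputT'_x₀`). -/
theorem ART'_x₀ (hc : G V c) (k : Fin 4) :
    (ART' @G @hG @hGR @χV @ν @ν' @hGR₀ @hGR₁ @hGR₂ @hGR₃ @μ @hpos @hΔ₁ @hΔ₂ @hΔ₃ V c hc k).x₀ =
      (AR @G @hG @hGR @χV @hGR₀ @hGR₁ @hGR₂ @hGR₃ @μ @hpos @hΔ₁ @hΔ₂ @hΔ₃ V c hc k).x₀ := by
  unfold ART'
  rw [archLineInputT'_x₀]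

/-- **(N1) for the transported read-off inputs**: every line weight of `ART'` is `archWeight L (μ c k)` — binder-1's `hAw_AR`
(`Binders/Real34PinsROG`) with `AR ↦ ART'` (#1228 `archLineInputT'_w`, theta-3 (E1) `archLineInputOf_w`). -/
theorem ART'_w (hc : G V c) (k : Fin 4) :
    (ART' @G @hG @hGR @χV @ν @ν' @hGR₀ @hGR₁ @hGR₂ @hGR₃ @μ @hpos @hΔ₁ @hΔ₂ @hΔ₃ V c hc k).w =
      ⇑(Literature.NumberTheory.Automorphic.archWeight (L : Type) (μ c k)) := by
  unfold ART'
  rw [archLineInputT'_w]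
  exact archLineInputOf_w _ k

end ReadOffT2

/-! ### § 2b the pin `SROGT'C` -/

section PinR2

variable
  (hGR : ∀ {L : CMField} {ι₁ : L →+* ℂ} (V : HermSpace3 L ι₁) (c : SeesawCtx L),
    (cmSplittingDatum (L : Type) finProdFinEquiv (frameD V) (frameD_real V) (frameD_ne V) (dW c.D) (dW_real c.D)
      (dW_ne c.D)).CompatibleSplitting)
  (hGR₀ : ∀ {L : CMField} {ι₁ : L →+* ℂ} (V : HermSpace3 L ι₁) (c : SeesawCtx L),
    (cmSplittingDatum (L : Type) (e₁) (frameD V) (frameD_real V) (frameD_ne V) (lineVec (L : Type) (dW c.D 0))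
      (fun _ => dW_real c.D 0) (fun _ => dW_ne c.D 0)).CompatibleSplitting)
  (hGR₁ : ∀ {L : CMField} {ι₁ : L →+* ℂ} (V : HermSpace3 L ι₁) (c : SeesawCtx L),
    (cmSplittingDatum (L : Type) (e₁) (frameD V) (frameD_real V) (frameD_ne V) (lineVec (L : Type) (dW c.D 1))
      (fun _ => dW_real c.D 1) (fun _ => dW_ne c.D 1)).CompatibleSplitting)
  (hGR₂ : ∀ {L : CMField} {ι₁ : L →+* ℂ} (V : HermSpace3 L ι₁) (c : SeesawCtx L),
    (cmSplittingDatum (L : Type) (e₁) (frameD V) (frameD_real V) (frameD_ne V) (lineVec (L : Type) (dW' c.D 0))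
      (fun _ => dW'_real c.D 0) (fun _ => dW'_ne c.D 0)).CompatibleSplitting)
  (hGR₃ : ∀ {L : CMField} {ι₁ : L →+* ℂ} (V : HermSpace3 L ι₁) (c : SeesawCtx L),
    (cmSplittingDatum (L : Type) (e₁) (frameD V) (frameD_real V) (frameD_ne V) (lineVec (L : Type) (dW' c.D 1))
      (fun _ => dW'_real c.D 1) (fun _ => dW'_ne c.D 1)).CompatibleSplitting)
  (μ : ∀ {L : CMField}, SeesawCtx L → Fin 4 → NumberField.InfinitePlace (L : Type) → ℤ)
  (hΔ₁ : ∀ {L : CMField} {ι₁ : L →+* ℂ} (V : HermSpace3 L ι₁) (c : SeesawCtx L), ∀ hc : GOG V c,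
    slotTypeVec V c (hGR V c) (hGR₀ V c) (hGR₁ V c) (hGR₂ V c) (hGR₃ V c) (hG_GOG V c hc) 1 -
      slotTypeVec V c (hGR V c) (hGR₀ V c) (hGR₁ V c) (hGR₂ V c) (hGR₃ V c) (hG_GOG V c hc) 0 = μ c 1 - μ c 0)
  (hΔ₂ : ∀ {L : CMField} {ι₁ : L →+* ℂ} (V : HermSpace3 L ι₁) (c : SeesawCtx L), ∀ hc : GOG V c,
    slotTypeVec V c (hGR V c) (hGR₀ V c) (hGR₁ V c) (hGR₂ V c) (hGR₃ V c) (hG_GOG V c hc) 2 -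
      slotTypeVec V c (hGR V c) (hGR₀ V c) (hGR₁ V c) (hGR₂ V c) (hGR₃ V c) (hG_GOG V c hc) 0 = μ c 2 - μ c 0)
  (hΔ₃ : ∀ {L : CMField} {ι₁ : L →+* ℂ} (V : HermSpace3 L ι₁) (c : SeesawCtx L), ∀ hc : GOG V c,
    slotTypeVec V c (hGR V c) (hGR₀ V c) (hGR₁ V c) (hGR₂ V c) (hGR₃ V c) (hG_GOG V c hc) 3 -
      slotTypeVec V c (hGR V c) (hGR₀ V c) (hGR₁ V c) (hGR₂ V c) (hGR₃ V c) (hG_GOG V c hc) 0 = μ c 3 - μ c 0)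

variable {L : CMField} {ι₁ : L →+* ℂ} (V : HermSpace3 L ι₁) (c : SeesawCtx L)

/-- `(P k).ΓU` of the constructed pin R2 (both branches). -/
theorem SROGT'C_P_ΓU (k : Fin 4) :
    ((SROGT'C @hGR @hGR₀ @hGR₁ @hGR₂ @hGR₃ @μ hΔ₁ hΔ₂ hΔ₃ V c).P k).ΓU = (V.latticeModel printFact_unitaryCompact_holds).Γ :=
  (SROGT'C @hGR @hGR₀ @hGR₁ @hGR₂ @hGR₃ @μ hΔ₁ hΔ₂ hΔ₃ V c).hΓU k

/-- under the OG guard `(SROGT'C … V c).ιinf = archInfOf V`. -/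
theorem SROGT'C_ιinf (hc : GOG V c) :
    (SROGT'C @hGR @hGR₀ @hGR₁ @hGR₂ @hGR₃ @μ hΔ₁ hΔ₂ hΔ₃ V c).ιinf = archInfOf V := by
  rw [SROGT'C_eq_archSideOfT' @hGR @hGR₀ @hGR₁ @hGR₂ @hGR₃ @μ hΔ₁ hΔ₂ hΔ₃ V c hc]; rfl

/-- under the OG guard `(SROGT'C … V c).Gfin = archFinOf V`. -/
theorem SROGT'C_Gfin (hc : GOG V c) :
    (SROGT'C @hGR @hGR₀ @hGR₁ @hGR₂ @hGR₃ @μ hΔ₁ hΔ₂ hΔ₃ V c).Gfin = archFinOf V := by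
  rw [SROGT'C_eq_archSideOfT' @hGR @hGR₀ @hGR₁ @hGR₂ @hGR₃ @μ hΔ₁ hΔ₂ hΔ₃ V c hc]; rfl

/-- D-1′'s frame junction `hι` at the constructed pin R2 under the OG guard (binder-1 `hι_total` shape). -/
theorem SROGT'C_ιinf_apply (hc : GOG V c) (hV : IsAnisotropic L V.Hm) (u : U21) :
    (SROGT'C @hGR @hGR₀ @hGR₁ @hGR₂ @hGR₃ @μ hΔ₁ hΔ₂ hΔ₃ V c).ιinf u =
      Adelic.regimeEquiv L V.Hm hV
        (UnitaryGroup.archSectionU21CM (L : Type) ι₁ V.Hm V.sylvesterFrame (sylvesterFrame_J V) u) := by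
  rw [SROGT'C_eq_archSideOfT' @hGR @hGR₀ @hGR₁ @hGR₂ @hGR₃ @μ hΔ₁ hΔ₂ hΔ₃ V c hc]
  exact archSideOfT'_ιinf_apply V c _ _ _ _ _ _ _ _ _ _ _ _ _ _ _ _ hV u

/-- (L3b) at the constructed pin R2 under the OG guard (binder-1 `hGfin_total` shape, with `finTranslate` spelled out). -/
theorem regimeEquiv_prodSymm_one_mem_SROGT'C_Gfin (hc : GOG V c) (hV : IsAnisotropic L V.Hm)
    (kf : ↥(UnitaryGroup.finAdelic (↥(maximalRealSubfield L)) (L : Type) (IsCMField.complexConj L) 3 V.Hm)) :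
    (Adelic.regimeEquiv L V.Hm hV ((UnitaryGroup.cmAdelicProdEquiv (L : Type) 3 V.Hm).symm (1, kf)) :
        (V.latticeModel printFact_unitaryCompact_holds).G) ∈
      (SROGT'C @hGR @hGR₀ @hGR₁ @hGR₂ @hGR₃ @μ hΔ₁ hΔ₂ hΔ₃ V c).Gfin := by
  rw [SROGT'C_Gfin @hGR @hGR₀ @hGR₁ @hGR₂ @hGR₃ @μ hΔ₁ hΔ₂ hΔ₃ V c hc]
  exact regimeEquiv_prodSymm_one_mem_archFinOf V hV kf

/-- under the OG guard the archimedean test function of line `k` of the constructed pin R2 is the (J-μ) read-off input's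
(`AR … k`, transported verbatim by `archLineInputT'`). -/
theorem SROGT'C_P_Φinf (hc : GOG V c) (k : Fin 4) :
    ((SROGT'C @hGR @hGR₀ @hGR₁ @hGR₂ @hGR₃ @μ hΔ₁ hΔ₂ hΔ₃ V c).P k).Φinf =
      (AR @GOG @hG_GOG @hGR @(@χVR @hGR @hGR₀ @hGR₁) @hGR₀ @hGR₁ @hGR₂ @hGR₃ @μ @hpos_GOG @hΔ₁ @hΔ₂ @hΔ₃ V c hc k).Φinf := by
  rw [SROGT'C_eq_archSideOfT' @hGR @hGR₀ @hGR₁ @hGR₂ @hGR₃ @μ hΔ₁ hΔ₂ hΔ₃ V c hc, archSideOfT'_P_Φinf]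
  unfold ART'
  rw [archLineInputT'_Φinf]

/-- under the OG guard the rational base point of line `k` of the constructed pin R2 is the (J-μ) read-off input's. -/
theorem SROGT'C_P_x₀ (hc : GOG V c) (k : Fin 4) :
    ((SROGT'C @hGR @hGR₀ @hGR₁ @hGR₂ @hGR₃ @μ hΔ₁ hΔ₂ hΔ₃ V c).P k).x₀ =
      (AR @GOG @hG_GOG @hGR @(@χVR @hGR @hGR₀ @hGR₁) @hGR₀ @hGR₁ @hGR₂ @hGR₃ @μ @hpos_GOG @hΔ₁ @hΔ₂ @hΔ₃ V c hc k).x₀ := by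
  rw [SROGT'C_eq_archSideOfT' @hGR @hGR₀ @hGR₁ @hGR₂ @hGR₃ @μ hΔ₁ hΔ₂ hΔ₃ V c hc, archSideOfT'_P_x₀]
  unfold ART'
  rw [archLineInputT'_x₀]

/-- **binder-1's weight facts at the constructed pin R2**: under the OG guard EVERY line weight of `SROGT'C … μ hΔ₁ hΔ₂ hΔ₃` is
`archWeight L (μ c k)` (the twists are invisible on `{1} × U(1)(𝔸_∞)`, `archLineInputT'_w`; theta-3 (E1) `archLineInputOf_w`). -/
theorem SROGT'C_P_w (hc : GOG V c) (k : Fin 4) :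
    ((SROGT'C @hGR @hGR₀ @hGR₁ @hGR₂ @hGR₃ @μ hΔ₁ hΔ₂ hΔ₃ V c).P k).w = ⇑(Literature.NumberTheory.Automorphic.archWeight (L : Type) (μ c k)) := by
  rw [SROGT'C_eq_archSideOfT' @hGR @hGR₀ @hGR₁ @hGR₂ @hGR₃ @μ hΔ₁ hΔ₂ hΔ₃ V c hc, archSideOfT'_P_w]
  unfold ART'
  rw [archLineInputT'_w]
  exact archLineInputOf_w _ k

/-- pointwise form of `SROGT'C_P_w`. -/
theorem SROGT'C_P_w_apply (hc : GOG V c) (k : Fin 4) (t : ↥(Literature.NumberTheory.Automorphic.relNormOneInfUnits (↥(maximalRealSubfield L)) L)) :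
    ((SROGT'C @hGR @hGR₀ @hGR₁ @hGR₂ @hGR₃ @μ hΔ₁ hΔ₂ hΔ₃ V c).P k).w t = Literature.NumberTheory.Automorphic.archWeight (L : Type) (μ c k) t := by
  rw [SROGT'C_P_w @hGR @hGR₀ @hGR₁ @hGR₂ @hGR₃ @μ hΔ₁ hΔ₂ hΔ₃ V c hc k]

/-- binder-1's **`op`** ((x-S), `SeesawCore.ofOp`) at the constructed pin R2 under the OG guard. -/
theorem op_SROGT'C (hc : GOG V c)
    (g : ↥(regimeSubgroup L V.Hm)) (t : NumberField.SeesawTorus (↥(maximalRealSubfield L)) L)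
    (φ₁ φ₂ : piSchwartzBruhat (↥(maximalRealSubfield L)) (Fin 3)) :
    cmPairRepTwist (L : Type) finProdFinEquiv (frameD V) (frameD_real V) (frameD_ne V) (dW c.D) (dW_real c.D) (dW_ne c.D) (hGR V c)
        (EtaChi.η (@χVR @hGR @hGR₀ @hGR₁) (@χWR @hGR @hGR₀ @hGR₁ @μ) V c)
        ((cmFrameEquiv (L : Type) (frameG V) V.Hm (frameD V) (frame_congr V)) (g : ↥(HodgeCM.Adelic.adelicUnitaryGroup (L : Type) V.Hm)),
          cmAdelicEquiv (L : Type) 2 (Matrix.diagonal (dW c.D)) (c.D.jT₁₂ t)) (tau12 V c.D φ₁ φ₂) =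
      tau12 V c.D (((SROGT'C @hGR @hGR₀ @hGR₁ @hGR₂ @hGR₃ @μ hΔ₁ hΔ₂ hΔ₃ V c).P 0).ω (g, NumberField.SeesawTorus.fst _ L t) φ₁)
        (((SROGT'C @hGR @hGR₀ @hGR₁ @hGR₂ @hGR₃ @μ hΔ₁ hΔ₂ hΔ₃ V c).P 1).ω (g, NumberField.SeesawTorus.snd _ L t) φ₂) := by
  rw [SROGT'C_eq_archSideOfT' @hGR @hGR₀ @hGR₁ @hGR₂ @hGR₃ @μ hΔ₁ hΔ₂ hΔ₃ V c hc]
  exact op_archSideOfT' V c _ _ _ _ _ _ _ _ _ _ _ _ _ _ _ _ g t φ₁ φ₂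

/-- binder-1's **`seesaw`** ((SS₃₄), `SeesawHyp34`) at the constructed pin R2 under the OG guard. -/
theorem seesaw34_SROGT'C (hc : GOG V c)
    (g : ↥(regimeSubgroup L V.Hm)) (t : NumberField.SeesawTorus (↥(maximalRealSubfield L)) L)
    (φ₂ φ₃ : piSchwartzBruhat (↥(maximalRealSubfield L)) (Fin 3)) :
    thetaDistLM (↥(maximalRealSubfield L)) (Fin 6)
        (cmPairRepTwist (L : Type) finProdFinEquiv (frameD V) (frameD_real V) (frameD_ne V) (dW c.D) (dW_real c.D) (dW_ne c.D) (hGR V c)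
          (EtaChi.η (@χVR @hGR @hGR₀ @hGR₁) (@χWR @hGR @hGR₀ @hGR₁ @μ) V c)
          ((cmFrameEquiv (L : Type) (frameG V) V.Hm (frameD V) (frame_congr V)) (g : ↥(HodgeCM.Adelic.adelicUnitaryGroup (L : Type) V.Hm)),
            cmAdelicEquiv (L : Type) 2 (Matrix.diagonal (dW c.D)) (c.D.jT₃₄ t)) (tau34 V c.D φ₂ φ₃)) =
      thetaDistLM (↥(maximalRealSubfield L)) (Fin 3)
          ((((SROGT'C @hGR @hGR₀ @hGR₁ @hGR₂ @hGR₃ @μ hΔ₁ hΔ₂ hΔ₃ V c).P 2).ω (g, NumberField.SeesawTorus.fst _ L t) φ₂)) *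
        thetaDistLM (↥(maximalRealSubfield L)) (Fin 3)
          ((((SROGT'C @hGR @hGR₀ @hGR₁ @hGR₂ @hGR₃ @μ hΔ₁ hΔ₂ hΔ₃ V c).P 3).ω (g, NumberField.SeesawTorus.snd _ L t) φ₃)) := by
  rw [SROGT'C_eq_archSideOfT' @hGR @hGR₀ @hGR₁ @hGR₂ @hGR₃ @μ hΔ₁ hΔ₂ hΔ₃ V c hc]
  exact seesaw34_archSideOfT' V c _ _ _ _ _ _ _ _ _ _ _ _ _ _ _ _ g t φ₂ φ₃

/-- the operator-level (34) identity at the constructed pin R2 under the OG guard. -/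
theorem op34_SROGT'C (hc : GOG V c)
    (g : ↥(regimeSubgroup L V.Hm)) (t : NumberField.SeesawTorus (↥(maximalRealSubfield L)) L)
    (φ₂ φ₃ : piSchwartzBruhat (↥(maximalRealSubfield L)) (Fin 3)) :
    cmPairRepTwist (L : Type) finProdFinEquiv (frameD V) (frameD_real V) (frameD_ne V) (dW c.D) (dW_real c.D) (dW_ne c.D) (hGR V c)
        (EtaChi.η (@χVR @hGR @hGR₀ @hGR₁) (@χWR @hGR @hGR₀ @hGR₁ @μ) V c)
        ((cmFrameEquiv (L : Type) (frameG V) V.Hm (frameD V) (frame_congr V)) (g : ↥(HodgeCM.Adelic.adelicUnitaryGroup (L : Type) V.Hm)),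
          cmAdelicEquiv (L : Type) 2 (Matrix.diagonal (dW c.D)) (c.D.jT₃₄ t)) (tau34 V c.D φ₂ φ₃) =
      tau34 V c.D (((SROGT'C @hGR @hGR₀ @hGR₁ @hGR₂ @hGR₃ @μ hΔ₁ hΔ₂ hΔ₃ V c).P 2).ω (g, NumberField.SeesawTorus.fst _ L t) φ₂)
        (((SROGT'C @hGR @hGR₀ @hGR₁ @hGR₂ @hGR₃ @μ hΔ₁ hΔ₂ hΔ₃ V c).P 3).ω (g, NumberField.SeesawTorus.snd _ L t) φ₃) := by
  rw [SROGT'C_eq_archSideOfT' @hGR @hGR₀ @hGR₁ @hGR₂ @hGR₃ @μ hΔ₁ hΔ₂ hΔ₃ V c hc]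
  exact op34_archSideOfT' V c _ _ _ _ _ _ _ _ _ _ _ _ _ _ _ _ g t φ₂ φ₃

end PinR2

/-! ## § 3 the same at the (J-μ)-closed pin `SROGT'CJ` (weight table `μ♯♯ := ArchSideTerm.muSharp₂₃ μ`) -/

section PinR2J

variable
  (hGR : ∀ {L : CMField} {ι₁ : L →+* ℂ} (V : HermSpace3 L ι₁) (c : SeesawCtx L),
    (cmSplittingDatum (L : Type) finProdFinEquiv (frameD V) (frameD_real V) (frameD_ne V) (dW c.D) (dW_real c.D)
      (dW_ne c.D)).CompatibleSplitting)
  (hGR₀ : ∀ {L : CMField} {ι₁ : L →+* ℂ} (V : HermSpace3 L ι₁) (c : SeesawCtx L),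
    (cmSplittingDatum (L : Type) (e₁) (frameD V) (frameD_real V) (frameD_ne V) (lineVec (L : Type) (dW c.D 0))
      (fun _ => dW_real c.D 0) (fun _ => dW_ne c.D 0)).CompatibleSplitting)
  (hGR₁ : ∀ {L : CMField} {ι₁ : L →+* ℂ} (V : HermSpace3 L ι₁) (c : SeesawCtx L),
    (cmSplittingDatum (L : Type) (e₁) (frameD V) (frameD_real V) (frameD_ne V) (lineVec (L : Type) (dW c.D 1))
      (fun _ => dW_real c.D 1) (fun _ => dW_ne c.D 1)).CompatibleSplitting)
  (hGR₂ : ∀ {L : CMField} {ι₁ : L →+* ℂ} (V : HermSpace3 L ι₁) (c : SeesawCtx L),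
    (cmSplittingDatum (L : Type) (e₁) (frameD V) (frameD_real V) (frameD_ne V) (lineVec (L : Type) (dW' c.D 0))
      (fun _ => dW'_real c.D 0) (fun _ => dW'_ne c.D 0)).CompatibleSplitting)
  (hGR₃ : ∀ {L : CMField} {ι₁ : L →+* ℂ} (V : HermSpace3 L ι₁) (c : SeesawCtx L),
    (cmSplittingDatum (L : Type) (e₁) (frameD V) (frameD_real V) (frameD_ne V) (lineVec (L : Type) (dW' c.D 1))
      (fun _ => dW'_real c.D 1) (fun _ => dW'_ne c.D 1)).CompatibleSplitting)
  (μ : ∀ {L : CMField}, SeesawCtx L → Fin 4 → NumberField.InfinitePlace (L : Type) → ℤ)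

variable {L : CMField} {ι₁ : L →+* ℂ} (V : HermSpace3 L ι₁) (c : SeesawCtx L)


-- port_pkg: scope closed for this part
end PinR2J
end SInstance
end HodgeCM.Model
end
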